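import Summits.BirchSwinnertonDyer.BirchSwinnertonDyer.Theorems.SignedLowerHalvesKobayashiLowerHalfLargeImageKuriharaRigidityThm74
import Summits.BirchSwinnertonDyer.Rank1Residual.Supersingular.KobayashiMainConjectureKuriharaRigidity
import Literature.NumberTheory.EllipticCurves.CuspFormLFunctionLevelConductorProofs
import Literature.NumberTheory.EllipticCurves.TateModuleContinuityProofs
import Literature.NumberTheory.EllipticCurves.TateModuleFreeProofs
import Literature.NumberTheory.EllipticCurves.KuriharaNumberInvariants
import HarnessLib

/-!
# Line `kurihara_rigidity` of crux `KobayashiLowerHalfLargeImage` (item stmt-BirchSwinnertonDyer-19001, route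
# `SignedLowerHalves`): the lead's two COMPOSITE binders «Kim Thm 1.11 ∘ Kobayashi Thm 7.4» and «Castella–Sano
# Thm 1 ∘ Kobayashi Thm 7.4» DERIVED — their Kobayashi half is the kernel theorem of the sibling file
# `…KuriharaRigidityThm74`, their Kato half the displayed statements of Kim 2026 Thm. 1.11 (1) ⟹ (3) and
# Castella–Sano 2026 Thm. 1 (i) ⟹ (ii) read on the tree's `η = 1` Coleman/Kato package (cell `bsd-ssimc`, seat
# `bsd-line-slh-p1-w2`; a `--supports … --as helper` file)

WHAT. The lead (`bsd-line-slh-p1`) of the line closed its two ENGINE stubs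
(`KuriharaRigidity.signedMC_of_kuriharaPartialInfty_eq_zero`, `KuriharaRigidity.signedMC_of_kimTamagawaDefect`,
file `Rank1Residual/Supersingular/KobayashiMainConjectureKuriharaRigidity.lean`, p606756) MODULO two binders
stated directly in the ± currency — `Kim2026_thm111_via_kobayashi74` ([cite]×2: C.-H. Kim, Amer. J. Math.
148 (2026) Thm. 1.11 (1) ⟹ (3) COMPOSED WITH S. Kobayashi, Invent. Math. 152 (2003) Thm. 7.4) and
`CastellaSano2026_thm1_via_kobayashi74_OPEN` ([claim] Castella–Sano arXiv:2601.14504 Thm. 1 (i) ⟹ (ii)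
COMPOSED WITH Kobayashi Thm. 7.4) — "because the tree has no predicate «Kato's main conjecture for `E` at
`p`»". The sibling `…KuriharaRigidityThm74` (this seat, p607446) runs Kobayashi's Thm. 7.4 (ii) at `η = 1`
IN THE KERNEL on the tree's `η = 1` package `Kobayashi2003.SignedColemanKatoData` (k3-c4x): Kato's main
identity read on the pinned objects (`char_Λ Y.X = char_Λ(I.H ⧸ d.Z)`) + Kobayashi Thm. 1.2 + the period
unit ⟹ `KobayashiMainConjecture W p ε`. THIS FILE composes: §1 `kim2026_thm111_via_kobayashi74_of_katoFrame`
— the lead's first binder FOLLOWS from the displayed statement `hKim` (= VERBATIM the body of the named fact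
`Literature.NumberTheory.EllipticCurves.Kim2026.thm111_katoMainIdentity_of_kuriharaNumber_ne_zero`, proposal
p607903, the `η = 1` twin of the accepted p534181; displayed here so that this file does not depend on that
proposal), Kobayashi Thm. 1.2 (`h12 : thm12_signedSelmerDual_finite_torsion`) and the period fact (`h5`);
§2 `castellaSano2026_thm1_via_kobayashi74_OPEN_of_katoFrame` — the second binder FOLLOWS from `hCS`
(= VERBATIM the body of `Literature.…CastellaSano2026.thm1_katoMainIdentity_of_kimTamagawaDefect_OPEN`,
proposal p607905, PREPRINT claim), `h12`, `h5`; §3 the two ENGINE stubs with their registered signatures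
VERBATIM from `{hKim resp. hCS, h12, h5}` (= the lead's engines fed with §1–§2). Glue: the certificate lives
on ANY newform `f` of `W` while the conjecture's frame carries THE newform at level `N_E`; the two coincide
(`IsNewformOf.level_eq_level`, strong multiplicity one, + `IsNewformOf.unique`).

NET EFFECT for the line (numbers, not adjectives): trust base of the two engines BEFORE = {composite binder
(Kim 1.11 ∘ Ko 7.4) resp. (CS 1 ∘ Ko 7.4), period fact}; AFTER = {Kim 1.11 (1) ⟹ (3) resp. CS Thm 1 (i) ⟹
(ii) read on Kato's pinned objects, Kobayashi Thm. 1.2, period fact} + the ACCEPTED `η = 1` package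
implicitly (its existence is bundled in the displayed statements exactly as in the `η`-sibling p534181) —
Kobayashi's Thm. 7.4 (ii) is no longer taken on faith. HONEST FRAMING (cell `bsd-ssimc`, D-0036/D-0074):
TOOL THEOREMS ONLY; no definition, no named fact minted here, no `sorry`, axioms standard; everything is
CONDITIONAL on the displayed `hKim` / `hCS` (one PUBLISHED theorem resp. one PREPRINT claim, read on the
package through the flagged zeta-line identification `Kim26-111-eta1-zeta-line` / `CS26-1-eta1-zeta-line`)
and on `h12`, `h5`; the class-wide crux, the line's HARD stubs (Kim's Conjecture 1.10 on X7) and the route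
are NOT closed; nothing is booked; BSD is not proved by any of this.
`--supports stmt-BirchSwinnertonDyer-19001 --as helper`.

References: [Kim2022StructureSelmer] Thm. 1.11 (PDF p. 8), §6 (PDF p. 31), Conj. 1.3, Conj. 1.10;
[CastellaSano2026] Thm. 1, Conj. 2, Prop. 2.2.3, §2.4; [Kobayashi2003] Thm. 1.2, §4–§5, Thm. 7.4 (p. 13);
[AtkinLehner1970] Thm. 4 (strong multiplicity one, via `IsNewformOf.level_eq_level`); [GreenbergVatsal2000]
§3 Rem. 3.4; [Mazur1978] Cor. 4.1.
-/

set_option autoImplicit false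
-- single-problem summit (D-0017): the doubled namespace component is by design
set_option linter.dupNamespace false

noncomputable section

open scoped Classical MatrixGroups ModularForm

open CongruenceSubgroup Field WeierstrassCurve Literature.NumberTheory.EllipticCurves
  Literature.NumberTheory.EllipticCurves.ModularForms Literature.NumberTheory.GaloisRepresentations
  Literature.NumberTheory.EllipticCurves.Rank1Residual Summit.BirchSwinnertonDyer.Rank1Residual.Supersingular
  Summit.BirchSwinnertonDyer.Rank1Residual.X4

namespace Summit.BirchSwinnertonDyer.BirchSwinnertonDyer.Theorems.KuriharaRigidity

/-! ## §1 The PUBLISHED binder «Kim 1.11 ∘ Kobayashi 7.4» from Kim 1.11 on the package + the kernel Thm. 7.4 -/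

/-- **`Kim2026_thm111_via_kobayashi74` DERIVED.** Displayed hypothesis `hKim` = VERBATIM the body of the named
fact `Kim2026.thm111_katoMainIdentity_of_kuriharaNumber_ne_zero` (C.-H. Kim, Amer. J. Math. 148 (2026) Thm.
1.11 (1) ⟹ (3) for `E := W` at a good `p ≥ 5` with `a_p = 0`, read on the `η = 1` package: a unit Kurihara
number at a cyclic level `n ∈ 𝒩₁` ⟹ for every sign and all pinned `I`, `Y` some package datum `d` with
`char_Λ Y.X = char_Λ(I.H ⧸ d.Z)`); `h12` = Kobayashi Thm. 1.2; `h5` = the period unit. CONCLUSION: the lead's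
composite binder `Kim2026_thm111_via_kobayashi74` (± currency). Proof: unfold the binder and
`KobayashiMainConjecture`; the conjecture's newform `f'` at level `N_E` IS the certificate's newform `f`
(`IsNewformOf.level_eq_level`, `IsNewformOf.unique`); `E[p]` irreducible from `ρ̄` onto; then
`kobayashiMainConjecture_of_katoMainConjectureFrame` (Kobayashi Thm. 7.4 (ii) in the kernel) on the frame
supplied by `hKim`. CONDITIONAL on `hKim`, `h12`, `h5`; closes nothing.
[cite: Kim2022StructureSelmer, Thm. 1.11 (1) ⟹ (3) (PDF p. 8), §6 (PDF p. 31)]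
[cite: Kobayashi2003, Thm. 7.4 (p. 13), Thm. 1.2 (p. 2)] [cite: AtkinLehner1970, Thm. 4] -/
theorem kim2026_thm111_via_kobayashi74_of_katoFrame
    (hKim : ∀ (W : WeierstrassCurve ℚ) [W.IsElliptic] [W.IsGloballyMinimal] (p : ℕ) [Fact p.Prime]
        [ContinuousSMul ℤ_[p] (W.tateModule p)] [Module.Free ℤ_[p] (W.tateModule p)]
        [Module.Finite ℤ_[p] (W.tateModule p)]
        {N : ℕ} [NeZero N] (f : CuspForm (Gamma0 N) 2) (ϖ : ℚ)
        (κ : ZpExtension ℚ p) (γ : absoluteGaloisGroup ℚ),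
        5 ≤ p → W.HasGoodReductionAtPrime p → W.frobeniusTrace p = 0 → IsNewformOf W f →
        (ϖ : ℝ) * W.realPeriodRat = plusPeriod f →
        κ.IsCyclotomic → κ.IsTopGenerator γ → IsCyclotomicVariable p γ →
        W.HasSurjectiveModNGaloisRep p →
        Nat.card {Q : (W.baseChange ℚ_[p]).toAffine.Point // (p : ℕ) • Q = 0} = 1 →
        ¬ p ∣ W.tamagawaProduct →
        (∃ u : ℚ, ‖(u : ℚ_[p])‖ = 1 ∧ W.realPeriodRat = u * plusPeriod f) →
      ∀ (n : ℕ) [NeZero n], Kato.IsKolyvaginProduct W p 1 n →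
        (∀ (ℓ : ℕ) [Fact ℓ.Prime], ℓ ∣ n →
          Nat.card {P : ((WeierstrassCurve.integralModelInt W).map
              (Int.castRingHom (ZMod ℓ))).toAffine.Point // p • P = 0} ≤ p) →
      ∀ ψ : (ℓ : ℕ) → (ZMod ℓ)ˣ →* Multiplicative (ZMod (p ^ 1)),
        (∀ ℓ ∈ n.primeFactors, Function.Surjective (ψ ℓ)) →
        kuriharaNumber f (p ^ 1) n ψ ≠ 0 →
      ∀ (ε : ℤˣ) (I : Kato2004.IwasawaH1Data W p κ γ) (Y : W.FineSelmerDualData κ γ),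
        ∃ d : Kobayashi2003.SignedColemanKatoData W p f ϖ κ γ ε I,
          Module.charIdeal (IwasawaAlgebra p) Y.X =
            Module.charIdeal (IwasawaAlgebra p) (I.H ⧸ d.Z))
    (h12 : Kobayashi2003.thm12_signedSelmerDual_finite_torsion)
    (h5 : realPeriodRat_eq_unit_mul_plusPeriod) :
    Kim2026_thm111_via_kobayashi74 := by
  intro W _ _ p _ hp5 hgood hap hs ht0 htam N _ f hf hper hunit ε
  have hpP : p.Prime := Fact.out
  haveI : ContinuousSMul ℤ_[p] (W.tateModule p) := TateModule.continuousSMul_padicInt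
  haveI : Module.Free ℤ_[p] (W.tateModule p) := W.module_free_tateModule_holds p
  haveI : Module.Finite ℤ_[p] (W.tateModule p) := W.module_finite_tateModule_holds p
  haveI : NeZero ((p : ℕ) : ℚ) := ⟨Nat.cast_ne_zero.mpr hpP.ne_zero⟩
  have hirr : W.HasIrreducibleModPGaloisRep p :=
    hasIrreducibleModPGaloisRep_of_hasSurjectiveModNGaloisRep W p hs
  refine kobayashiMainConjecture_of_katoMainConjectureFrame W p h12 h5 hp5 hgood hap hirr ε ?_
  intro κ γ hκ hγ hγc _ f' hf' ϖ hϖ I Y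
  -- the conjecture's newform `f'` (level `N_E`) is the certificate's newform `f` (level `N`)
  obtain ⟨n, hn0, hn, hcyc, ψ, hψ, hne⟩ := hunit
  haveI : NeZero n := hn0
  have hN : N = W.conductorNorm ℤ := hf.level_eq_level hf'
  subst hN
  have hff : f = f' := hf.unique hf'
  subst hff
  exact hKim W p f ϖ κ γ hp5 hgood hap hf hϖ hκ hγ hγc hs ht0 htam hper n hn
    (fun ℓ _ hℓ => hcyc ℓ hℓ) ψ hψ hne ε I Y

/-! ## §2 The PREPRINT binder «Castella–Sano Thm 1 ∘ Kobayashi 7.4» from CS Thm 1 on the package + the kernel Thm. 7.4 -/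

/-- **`CastellaSano2026_thm1_via_kobayashi74_OPEN` DERIVED.** Displayed hypothesis `hCS` = VERBATIM the body
of the OPEN binder `CastellaSano2026.thm1_katoMainIdentity_of_kimTamagawaDefect_OPEN` (Castella–Sano,
arXiv:2601.14504, PREPRINT, Thm. 1 (i) ⟹ (ii) for `E := W` non-CM at a good `p ≥ 5` with `a_p = 0`, `ρ̄`
onto, (manin) as the period transfer; hypothesis Kim's Tamagawa-defect identity `∂^{(∞)}(δ̃) = ord_p Tam_E`
over cyclic levels; conclusion Kato's main identity read on the `η = 1` package); `h12`, `h5` as in §1.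
CONCLUSION: the lead's composite binder `CastellaSano2026_thm1_via_kobayashi74_OPEN`. Same proof as §1
(`KimTamagawaDefectAt W p f` unfolds to the displayed equality). CONDITIONAL on `hCS` (a PREPRINT claim —
never a theorem), `h12`, `h5`; closes nothing. [claim: CastellaSano2026, status: under-review]
[cite: Kobayashi2003, Thm. 7.4 (p. 13), Thm. 1.2 (p. 2)] [cite: AtkinLehner1970, Thm. 4] -/
theorem castellaSano2026_thm1_via_kobayashi74_OPEN_of_katoFrame
    (hCS : ∀ (W : WeierstrassCurve ℚ) [W.IsElliptic] [W.IsGloballyMinimal] (p : ℕ) [Fact p.Prime]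
        [ContinuousSMul ℤ_[p] (W.tateModule p)] [Module.Free ℤ_[p] (W.tateModule p)]
        [Module.Finite ℤ_[p] (W.tateModule p)]
        {N : ℕ} [NeZero N] (f : CuspForm (Gamma0 N) 2) (ϖ : ℚ)
        (κ : ZpExtension ℚ p) (γ : absoluteGaloisGroup ℚ),
        5 ≤ p → W.HasGoodReductionAtPrime p → W.frobeniusTrace p = 0 → IsNewformOf W f →
        (ϖ : ℝ) * W.realPeriodRat = plusPeriod f →
        κ.IsCyclotomic → κ.IsTopGenerator γ → IsCyclotomicVariable p γ →
        ¬ W.HasCM → W.HasSurjectiveModNGaloisRep p →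
        (∃ u : ℚ, ‖(u : ℚ_[p])‖ = 1 ∧ W.realPeriodRat = u * plusPeriod f) →
        kuriharaPartialInfty W p f = (padicValNat p W.tamagawaProduct : ℕ∞) →
      ∀ (ε : ℤˣ) (I : Kato2004.IwasawaH1Data W p κ γ) (Y : W.FineSelmerDualData κ γ),
        ∃ d : Kobayashi2003.SignedColemanKatoData W p f ϖ κ γ ε I,
          Module.charIdeal (IwasawaAlgebra p) Y.X =
            Module.charIdeal (IwasawaAlgebra p) (I.H ⧸ d.Z))
    (h12 : Kobayashi2003.thm12_signedSelmerDual_finite_torsion)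
    (h5 : realPeriodRat_eq_unit_mul_plusPeriod) :
    CastellaSano2026_thm1_via_kobayashi74_OPEN := by
  intro W _ _ p _ hp5 hgood hap hcm hs N _ f hf hper hdef ε
  have hpP : p.Prime := Fact.out
  haveI : ContinuousSMul ℤ_[p] (W.tateModule p) := TateModule.continuousSMul_padicInt
  haveI : Module.Free ℤ_[p] (W.tateModule p) := W.module_free_tateModule_holds p
  haveI : Module.Finite ℤ_[p] (W.tateModule p) := W.module_finite_tateModule_holds p
  haveI : NeZero ((p : ℕ) : ℚ) := ⟨Nat.cast_ne_zero.mpr hpP.ne_zero⟩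
  have hirr : W.HasIrreducibleModPGaloisRep p :=
    hasIrreducibleModPGaloisRep_of_hasSurjectiveModNGaloisRep W p hs
  refine kobayashiMainConjecture_of_katoMainConjectureFrame W p h12 h5 hp5 hgood hap hirr ε ?_
  intro κ γ hκ hγ hγc _ f' hf' ϖ hϖ I Y
  have hN : N = W.conductorNorm ℤ := hf.level_eq_level hf'
  subst hN
  have hff : f = f' := hf.unique hf'
  subst hff
  exact hCS W p f ϖ κ γ hp5 hgood hap hf hϖ hκ hγ hγc hcm hs hper hdef ε I Y

/-! ## §3 The two ENGINE stubs of the line, signatures VERBATIM, from the finer inputs -/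

/-- **ENGINE A `stub_signedMC_of_kuriharaPartialInfty_eq_zero` (registered signature VERBATIM) from
`{hKim, h12, h5}`**: the lead's engine `KuriharaRigidity.signedMC_of_kuriharaPartialInfty_eq_zero` fed with
§1. At `p ≥ 5` good with `a_p = 0`, `ρ̄` onto, `p ∤ ∏ c_ℓ`: `∂^{(∞)}(δ̃) = 0` for the newform(s) of `W` ⟹
`KobayashiMainConjecture W p ε` for every sign. CONDITIONAL on the displayed `hKim` (Kim 1.11 on the
package), `h12`, `h5`; closes nothing. [cite: Kim2022StructureSelmer, Thm. 1.11 (1) ⟹ (3) (PDF p. 8)]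
[cite: Kobayashi2003, Thm. 7.4 (p. 13), Thm. 1.2 (p. 2)] -/
theorem signedMC_of_kuriharaPartialInfty_eq_zero_of_katoFrame
    (hKim : ∀ (W : WeierstrassCurve ℚ) [W.IsElliptic] [W.IsGloballyMinimal] (p : ℕ) [Fact p.Prime]
        [ContinuousSMul ℤ_[p] (W.tateModule p)] [Module.Free ℤ_[p] (W.tateModule p)]
        [Module.Finite ℤ_[p] (W.tateModule p)]
        {N : ℕ} [NeZero N] (f : CuspForm (Gamma0 N) 2) (ϖ : ℚ)
        (κ : ZpExtension ℚ p) (γ : absoluteGaloisGroup ℚ),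
        5 ≤ p → W.HasGoodReductionAtPrime p → W.frobeniusTrace p = 0 → IsNewformOf W f →
        (ϖ : ℝ) * W.realPeriodRat = plusPeriod f →
        κ.IsCyclotomic → κ.IsTopGenerator γ → IsCyclotomicVariable p γ →
        W.HasSurjectiveModNGaloisRep p →
        Nat.card {Q : (W.baseChange ℚ_[p]).toAffine.Point // (p : ℕ) • Q = 0} = 1 →
        ¬ p ∣ W.tamagawaProduct →
        (∃ u : ℚ, ‖(u : ℚ_[p])‖ = 1 ∧ W.realPeriodRat = u * plusPeriod f) →
      ∀ (n : ℕ) [NeZero n], Kato.IsKolyvaginProduct W p 1 n →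
        (∀ (ℓ : ℕ) [Fact ℓ.Prime], ℓ ∣ n →
          Nat.card {P : ((WeierstrassCurve.integralModelInt W).map
              (Int.castRingHom (ZMod ℓ))).toAffine.Point // p • P = 0} ≤ p) →
      ∀ ψ : (ℓ : ℕ) → (ZMod ℓ)ˣ →* Multiplicative (ZMod (p ^ 1)),
        (∀ ℓ ∈ n.primeFactors, Function.Surjective (ψ ℓ)) →
        kuriharaNumber f (p ^ 1) n ψ ≠ 0 →
      ∀ (ε : ℤˣ) (I : Kato2004.IwasawaH1Data W p κ γ) (Y : W.FineSelmerDualData κ γ),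
        ∃ d : Kobayashi2003.SignedColemanKatoData W p f ϖ κ γ ε I,
          Module.charIdeal (IwasawaAlgebra p) Y.X =
            Module.charIdeal (IwasawaAlgebra p) (I.H ⧸ d.Z))
    (h12 : Kobayashi2003.thm12_signedSelmerDual_finite_torsion)
    (h5 : realPeriodRat_eq_unit_mul_plusPeriod) :
    ∀ (W : WeierstrassCurve ℚ) [W.IsElliptic] [W.IsGloballyMinimal] (p : ℕ) [Fact p.Prime],
      5 ≤ p → W.HasGoodReductionAtPrime p → W.frobeniusTrace p = 0 → Surj W p →
      ¬ p ∣ W.tamagawaProduct →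
      (∀ [NeZero (W.conductorNorm ℤ)] (f : CuspForm (Gamma0 (W.conductorNorm ℤ)) 2),
          IsNewformOf W f → kuriharaPartialInfty W p f = 0) →
      ∀ ε : ℤˣ, KobayashiMainConjecture W p ε :=
  _root_.Summit.BirchSwinnertonDyer.Rank1Residual.Supersingular.KuriharaRigidity.signedMC_of_kuriharaPartialInfty_eq_zero
    (kim2026_thm111_via_kobayashi74_of_katoFrame hKim h12 h5) h5

/-- **ENGINE B `stub_signedMC_of_kimTamagawaDefect` (registered signature VERBATIM, reshape r2) from
`{hCS, h12, h5}`**: the lead's engine `KuriharaRigidity.signedMC_of_kimTamagawaDefect` fed with §2. At `p ≥ 5`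
good with `a_p = 0`, `E` non-CM, `ρ̄` onto: Kim's Tamagawa-defect identity for the newform(s) of `W` ⟹
`KobayashiMainConjecture W p ε` for every sign. CONDITIONAL on the displayed `hCS` (PREPRINT claim on the
package — never a theorem), `h12`, `h5`; closes nothing. [claim: CastellaSano2026, status: under-review]
[cite: Kobayashi2003, Thm. 7.4 (p. 13), Thm. 1.2 (p. 2)] -/
theorem signedMC_of_kimTamagawaDefect_of_katoFrame
    (hCS : ∀ (W : WeierstrassCurve ℚ) [W.IsElliptic] [W.IsGloballyMinimal] (p : ℕ) [Fact p.Prime]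
        [ContinuousSMul ℤ_[p] (W.tateModule p)] [Module.Free ℤ_[p] (W.tateModule p)]
        [Module.Finite ℤ_[p] (W.tateModule p)]
        {N : ℕ} [NeZero N] (f : CuspForm (Gamma0 N) 2) (ϖ : ℚ)
        (κ : ZpExtension ℚ p) (γ : absoluteGaloisGroup ℚ),
        5 ≤ p → W.HasGoodReductionAtPrime p → W.frobeniusTrace p = 0 → IsNewformOf W f →
        (ϖ : ℝ) * W.realPeriodRat = plusPeriod f →
        κ.IsCyclotomic → κ.IsTopGenerator γ → IsCyclotomicVariable p γ →
        ¬ W.HasCM → W.HasSurjectiveModNGaloisRep p →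
        (∃ u : ℚ, ‖(u : ℚ_[p])‖ = 1 ∧ W.realPeriodRat = u * plusPeriod f) →
        kuriharaPartialInfty W p f = (padicValNat p W.tamagawaProduct : ℕ∞) →
      ∀ (ε : ℤˣ) (I : Kato2004.IwasawaH1Data W p κ γ) (Y : W.FineSelmerDualData κ γ),
        ∃ d : Kobayashi2003.SignedColemanKatoData W p f ϖ κ γ ε I,
          Module.charIdeal (IwasawaAlgebra p) Y.X =
            Module.charIdeal (IwasawaAlgebra p) (I.H ⧸ d.Z))
    (h12 : Kobayashi2003.thm12_signedSelmerDual_finite_torsion)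
    (h5 : realPeriodRat_eq_unit_mul_plusPeriod) :
    ∀ (W : WeierstrassCurve ℚ) [W.IsElliptic] [W.IsGloballyMinimal] (p : ℕ) [Fact p.Prime],
      5 ≤ p → W.HasGoodReductionAtPrime p → W.frobeniusTrace p = 0 → ¬ W.HasCM → Surj W p →
      (∀ [NeZero (W.conductorNorm ℤ)] (f : CuspForm (Gamma0 (W.conductorNorm ℤ)) 2),
          IsNewformOf W f →
            kuriharaPartialInfty W p f = (padicValNat p W.tamagawaProduct : ℕ∞)) →
      ∀ ε : ℤˣ, KobayashiMainConjecture W p ε :=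
  _root_.Summit.BirchSwinnertonDyer.Rank1Residual.Supersingular.KuriharaRigidity.signedMC_of_kimTamagawaDefect
    (castellaSano2026_thm1_via_kobayashi74_OPEN_of_katoFrame hCS h12 h5) h5

end Summit.BirchSwinnertonDyer.BirchSwinnertonDyer.Theorems.KuriharaRigidity

end
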